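import Mathlib
import Summits.ValiantsHypothesis.ValiantsHypothesis.Theorems.FifoMatchingNNDivisionHardPadWordArcBand
import Summits.ValiantsHypothesis.ValiantsHypothesis.Theorems.FifoMatchingNNDivisionHardLocalCofactor
import Summits.ValiantsHypothesis.ValiantsHypothesis.Theorems.FifoMatchingNNDivisionHardSupportBetween
import Summits.ValiantsHypothesis.ValiantsHypothesis.Theorems.FifoMatchingNNDivisionHardCorSandwich
import Summits.ValiantsHypothesis.ValiantsHypothesis.Theses.FifoMatching
import HarnessLib

/-!
# Route FifoMatching — crux `NNDivisionHard` (stmt-ValiantsHypothesis-21181): certificates must be SCALE-COVERING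
# (BAND-AVOIDING cofactors are not certificates, at every admissible scale)

By `PadWordArcBand.exists_thick_measure_of_le_band`, for EVERY `u ≥ 1` with `T(u) = 192u⁵ + 176u⁴ + 29u³ + 24u + 4 ≤ n` and
the band estimate, the thick-queue measure with parameter `u` is a spread measure (`β = 2N (3/4)^{4u}`) living on matchings
all of whose arcs have length in the band `B(u) = [8u⁴ + 2u³ + 1, 16u⁴ + 8u³ − 1]`.  By the local-cofactor reduction
(`LocalCofactor.complexity_avoidingFace_le_of_local`, any `I`) and the support-between union bound, a spread measure avoiding
`I` makes every `I`-local cofactor expensive.  Hence: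

* `support_avoidingFace_subset`, `arcExponent_mem_support_avoidingFace` — the `I`-avoiding face inside `supp NN_n` (any `I`);
* ★ `local_spreadLaw` — **GENERIC LAW**: a probability weighting supported on `I`-avoiding matchings with balanced-split mass
  `≤ β` gives `1 ≤ 4 (L₊(NN_n·h) + 1) (n+1)² β` for every `h ≠ 0` with `vars h ⊆ I`;
* `polylog_add_le`, `band_estimate_of_log` — bookkeeping: `(ℓ+c)^c + 3ℓ + 8 ≤ (ℓ+c+2)^{c+2}` (`ℓ ≥ 2`); the band estimate
  `2N e^{−m²/(2N)} 2^N ≤ 2^N/(2N)` from the integer condition `20 n (log₂ n + 1) ≤ u⁶` (`m = u³`, `N ≤ 2n`);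
* ★★ `bandAvoiding_lower_bound` — **for every admissible `u` (`T(u) ≤ n`, `20 n (log₂ n + 1) ≤ u⁶`) and every `h ≠ 0` NONE of
  whose variables `x_(i,j)` has `j − i ∈ B(u)`: `2^u ≤ 16 n (n+1)² (L₊(NN_n · h) + 1)`**;
* ★★ `bandAvoiding_not_certificate_qp` — for every `c`, eventually in `n`: for every admissible `u`, every `B(u)`-avoiding
  `h ≠ 0` satisfies the crux inequality `2^((log₂ n + c)^c) < L₊(NN_n · h) + L₊(h)`.  Admissible `u` range over
  `[(20 n (log₂ n+1))^{1/6}, ≈ (n/192)^{1/5}]`, so the bands `B(u)` (ratio `< 2`) sweep all arc lengths from `Θ((n log n)^{2/3})`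
  to `Θ(n^{4/5})`: **a quasi-polynomial certificate cofactor must contain an arc in EVERY such band — it is SCALE-COVERING**;
* ★ BY NAME `nnDivisionHard_iff_scaleCoveringTier` — `NNDivisionHard` ⟺ the crux inequality for the scale-covering cofactors.

HONEST FRAMING: a structural constraint on certificates for ONE candidate family (the residual of stmt-21181 is now: grand
residual ∧ block-dense ∧ prefix/adjacent-non-generic ∧ SCALE-COVERING); stmt-21181 stays OPEN; nothing here bears on `NNNotVP`
or on VP ≠ VNP (NOT proved).  No definitions, no named facts.
References: Hrubeš–Yehudayoff 2021 §6 Problem 2 [HrubesYehudayoff2021]; Bürgisser 2000 Rem. 2.7 [Burgisser2000].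
-/

noncomputable section

-- Sub = Summit single-conjunct layout: the duplicated namespace component is mandated by the tree.
set_option linter.dupNamespace false
set_option autoImplicit false

namespace Summit.ValiantsHypothesis.ValiantsHypothesis.Theorems.FifoMatching.NNDivisionHard.BandLocal

open Finset MvPolynomial Literature.Computability.AlgebraicComplexity
open Summit.ValiantsHypothesis.ValiantsHypothesis.Theorems.FifoMatching.NNDivisionHard.LocalCofactor
  (complexity_avoidingFace_le_of_local)
open Summit.ValiantsHypothesis.ValiantsHypothesis.Theorems.FifoMatching.NNDivisionHard.SupportBetween
  (one_le_complexity_mul_of_spread_of_support_between)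
open Summit.ValiantsHypothesis.ValiantsHypothesis.Theorems.FifoMatching.NNDivisionHard.PadWordArcBand
  (exists_thick_measure_of_le_band)
open scoped NNReal BigOperators

variable {n : ℕ}

/-! ### §1 The `I`-avoiding face and the generic local law -/

/-- The `I`-avoiding face has support inside that of `NN_n`. [folklore] -/
theorem support_avoidingFace_subset (I : Finset (Fin (2 * n) × Fin (2 * n))) :
    (∑ M ∈ (nestFreeMatchings (2 * n)).filter (fun M => ∀ i ∈ openers M, (i, M i) ∉ I),
        arcMonomial ℝ≥0 M).support ⊆ (nestFreeMatchingPoly n ℝ≥0).support := by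
  classical
  intro x hx
  rw [support_sum_arcMonomial ((Finset.filter_subset _ _).trans nestFreeMatchings_subset_perfectMatchings),
    Finset.mem_image] at hx
  obtain ⟨M, hM, rfl⟩ := hx
  rw [support_nestFreeMatchingPoly, Finset.mem_image]
  exact ⟨M, (Finset.mem_filter.1 hM).1, rfl⟩

/-- A matching avoiding `I` lies in the `I`-avoiding face. [folklore] -/
theorem arcExponent_mem_support_avoidingFace (I : Finset (Fin (2 * n) × Fin (2 * n))) {M : Fin (2 * n) → Fin (2 * n)}
    (hM : M ∈ nestFreeMatchings (2 * n)) (havoid : ∀ i ∈ openers M, (i, M i) ∉ I) :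
    arcExponent M ∈ (∑ M ∈ (nestFreeMatchings (2 * n)).filter (fun M => ∀ i ∈ openers M, (i, M i) ∉ I),
        arcMonomial ℝ≥0 M).support := by
  classical
  rw [mem_support_iff, coeff_sum_arcMonomial ((Finset.filter_subset _ _).trans nestFreeMatchings_subset_perfectMatchings),
    if_pos ⟨M, Finset.mem_filter.2 ⟨hM, havoid⟩, rfl⟩]
  exact one_ne_zero

/-- ★ **GENERIC LOCAL LAW.**  Let `n ≥ 3`, `I` any set of arc variables, `μ` a probability weighting of the nest-free perfect
matchings of `[2n]` supported on matchings AVOIDING `I` and respecting every balanced split with mass `≤ β`.  Then every `h ≠ 0`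
with `vars h ⊆ I` has `1 ≤ 4 · (L₊(NN_n · h) + 1) · (n+1)² · β`. [cite: Burgisser2000, Rem. 2.7] [cite: HrubesYehudayoff2021, §6 Problem 2] -/
theorem local_spreadLaw (hn : 3 ≤ n) (I : Finset (Fin (2 * n) × Fin (2 * n))) {β : ℝ≥0}
    (μ : (Fin (2 * n) → Fin (2 * n)) → ℝ≥0) (hμ : ∑ M ∈ nestFreeMatchings (2 * n), μ M = 1)
    (hμI : ∀ M ∈ nestFreeMatchings (2 * n), μ M ≠ 0 → ∀ i ∈ openers M, (i, M i) ∉ I)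
    (hβ : ∀ S : Finset (Fin (2 * n)), 2 * n < 3 * S.card → 3 * S.card ≤ 4 * n →
      (∑ M ∈ (nestFreeMatchings (2 * n)).filter (fun M => ∀ i, i ∈ S ↔ M i ∈ S), μ M) ≤ β)
    {h : MvPolynomial (Fin (2 * n) × Fin (2 * n)) ℝ≥0} (hh : h ≠ 0) (hloc : ∀ e ∈ h.vars, e ∈ I) :
    (1 : ℝ) ≤ 4 * ((complexity (nestFreeMatchingPoly n ℝ≥0 * h) + 1 : ℕ) : ℝ) * ((n : ℝ) + 1) ^ 2 * (β : ℝ) := by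
  -- some matching of the support avoids `I`
  have hex : ∃ M ∈ nestFreeMatchings (2 * n), ∀ i ∈ openers M, (i, M i) ∉ I := by
    obtain ⟨M, hM, hμM⟩ := Finset.exists_ne_zero_of_sum_ne_zero (by rw [hμ]; exact one_ne_zero)
    exact ⟨M, hM, hμI M hM hμM⟩
  have hred := complexity_avoidingFace_le_of_local I hex hh hloc
  have hone := one_le_complexity_mul_of_spread_of_support_between hn (support_avoidingFace_subset I) μ hμ
    (fun M hM hμM => arcExponent_mem_support_avoidingFace I hM (hμI M hM hμM)) hβ
  set F := complexity (∑ M ∈ (nestFreeMatchings (2 * n)).filter (fun M => ∀ i ∈ openers M, (i, M i) ∉ I),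
        arcMonomial ℝ≥0 M) with hF
  have hle : (F : ℝ) ≤ ((complexity (nestFreeMatchingPoly n ℝ≥0 * h) + 1 : ℕ) : ℝ) := by
    exact_mod_cast hred
  calc (1 : ℝ) ≤ 4 * (F : ℝ) * ((n : ℝ) + 1) ^ 2 * (β : ℝ) := hone
    _ ≤ 4 * ((complexity (nestFreeMatchingPoly n ℝ≥0 * h) + 1 : ℕ) : ℝ) * ((n : ℝ) + 1) ^ 2 * (β : ℝ) := by
        gcongr

/-! ### §2 Bookkeeping -/

/-- Exponent bookkeeping: `(ℓ + c)^c + 3ℓ + 8 ≤ (ℓ + c + 2)^(c + 2)` for `ℓ ≥ 2`. [folklore] -/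
theorem polylog_add_le (ℓ c : ℕ) (hℓ : 2 ≤ ℓ) : (ℓ + c) ^ c + 3 * ℓ + 8 ≤ (ℓ + c + 2) ^ (c + 2) := by
  have h1 : (ℓ + c) ^ c * (ℓ + 2) ^ 2 ≤ (ℓ + c + 2) ^ (c + 2) := by
    calc (ℓ + c) ^ c * (ℓ + 2) ^ 2 ≤ (ℓ + c + 2) ^ c * (ℓ + c + 2) ^ 2 :=
          Nat.mul_le_mul (Nat.pow_le_pow_left (by omega) c) (Nat.pow_le_pow_left (by omega) 2)
      _ = (ℓ + c + 2) ^ (c + 2) := by rw [← pow_add]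
  have ha : 1 ≤ (ℓ + c) ^ c := Nat.one_le_pow _ _ (by omega)
  have hb : 3 * ℓ + 9 ≤ (ℓ + 2) ^ 2 := by nlinarith
  have h2 : (ℓ + c) ^ c + (ℓ + 2) ^ 2 ≤ (ℓ + c) ^ c * (ℓ + 2) ^ 2 + 1 := by
    have hb1 : 1 ≤ (ℓ + 2) ^ 2 := by nlinarith
    nlinarith
  omega

/-- `16 n (n+1)² < 2^(3 log₂ n + 7)`. [folklore] -/
theorem sixteen_mul_lt_two_pow (n : ℕ) : 16 * n * (n + 1) ^ 2 < 2 ^ (3 * Nat.log 2 n + 7) := by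
  have hP : n < 2 ^ (Nat.log 2 n + 1) := Nat.lt_pow_succ_log_self one_lt_two n
  have hP1 : n + 1 ≤ 2 ^ (Nat.log 2 n + 1) := hP
  have h1 : (n + 1) ^ 2 ≤ (2 ^ (Nat.log 2 n + 1)) ^ 2 := Nat.pow_le_pow_left hP1 2
  have hpos : 0 < (2 ^ (Nat.log 2 n + 1)) ^ 2 := by positivity
  calc 16 * n * (n + 1) ^ 2 ≤ 16 * n * (2 ^ (Nat.log 2 n + 1)) ^ 2 := Nat.mul_le_mul_left _ h1
    _ < 16 * 2 ^ (Nat.log 2 n + 1) * (2 ^ (Nat.log 2 n + 1)) ^ 2 := by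
        apply Nat.mul_lt_mul_of_lt_of_le _ le_rfl hpos
        exact Nat.mul_lt_mul_of_pos_left hP (by norm_num)
    _ = 2 ^ (3 * Nat.log 2 n + 7) := by
        rw [← pow_mul, show (16 : ℕ) = 2 ^ 4 by norm_num, ← pow_add, ← pow_add]
        ring_nf

/-- **The band estimate from an integer condition.**  If `m² ≥ 20 n (log₂ n + 1)`, `1 ≤ N ≤ 2n`, then
`2N e^{−m²/(2N)} 2^N ≤ 2^N / (2N)` (i.e. `4N² e^{−m²/(2N)} ≤ 1`). [folklore] -/
theorem band_estimate_of_log {n N : ℕ} {m : ℕ} (hNpos : 0 < N) (hNle : N ≤ 2 * n)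
    (hlog : 20 * n * (Nat.log 2 n + 1) ≤ m ^ 2) :
    2 * (N : ℝ) * Real.exp (-((m : ℝ) ^ 2 / (2 * N))) * 2 ^ N ≤ 2 ^ N / (2 * N) := by
  have hNr : (0 : ℝ) < N := by exact_mod_cast hNpos
  have hnpos : 0 < n := by omega
  have hnr : (0 : ℝ) < n := by exact_mod_cast hnpos
  have hN2 : (N : ℝ) ≤ 2 * n := by exact_mod_cast hNle
  -- `log (4 N²) ≤ (2 log₂ n + 6) log 2 < 5 (log₂ n + 1) ≤ m² / (2N)`
  have hl2 := Real.log_two_lt_d9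
  have hl2pos : 0 < Real.log 2 := Real.log_pos one_lt_two
  have hlogn : Real.log n < (Nat.log 2 n + 1 : ℕ) * Real.log 2 := by
    have hlt : (n : ℝ) < (2 : ℝ) ^ (Nat.log 2 n + 1) := by
      exact_mod_cast Nat.lt_pow_succ_log_self one_lt_two n
    have := Real.log_lt_log hnr hlt
    rwa [Real.log_pow] at this
  have hlogN : Real.log N ≤ Real.log 2 + Real.log n := by
    rw [← Real.log_mul (by norm_num) hnr.ne']
    exact Real.log_le_log hNr hN2
  have hlog4 : Real.log (4 * (N : ℝ) ^ 2) = 2 * Real.log 2 + 2 * Real.log N := by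
    rw [Real.log_mul (by norm_num) (by positivity), Real.log_pow, show (4 : ℝ) = 2 ^ 2 by norm_num, Real.log_pow]
    push_cast
    ring
  have hkey : Real.log (4 * (N : ℝ) ^ 2) ≤ (m : ℝ) ^ 2 / (2 * N) := by
    have hm2 : (20 : ℝ) * n * ((Nat.log 2 n + 1 : ℕ) : ℝ) ≤ (m : ℝ) ^ 2 := by exact_mod_cast hlog
    have hℓ0 : (0 : ℝ) ≤ ((Nat.log 2 n + 1 : ℕ) : ℝ) := by positivity
    rw [le_div_iff₀ (by positivity), hlog4]
    -- `(2 log 2 + 2 log N) 2N ≤ (2 log2 + 2 (log 2 + (ℓ+1) log 2)) 4n = (4 + 2(ℓ+1)) log2 · 4n ≤ 20 n (ℓ+1)`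
    have h1 : 2 * Real.log 2 + 2 * Real.log N ≤ (2 * ((Nat.log 2 n + 1 : ℕ) : ℝ) + 4) * Real.log 2 := by
      nlinarith
    have h2 : (2 * ((Nat.log 2 n + 1 : ℕ) : ℝ) + 4) * Real.log 2 * (2 * N)
        ≤ (2 * ((Nat.log 2 n + 1 : ℕ) : ℝ) + 4) * 0.6931471808 * (4 * n) := by
      have ha : (0 : ℝ) ≤ 2 * ((Nat.log 2 n + 1 : ℕ) : ℝ) + 4 := by positivity
      have := mul_le_mul (mul_le_mul_of_nonneg_left hl2.le ha) (by linarith : (2 : ℝ) * N ≤ 4 * n)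
        (by positivity) (by positivity)
      exact this
    have hℓ1 : (1 : ℝ) ≤ ((Nat.log 2 n + 1 : ℕ) : ℝ) := by exact_mod_cast Nat.succ_le_succ (Nat.zero_le _)
    have h3 : (2 * ((Nat.log 2 n + 1 : ℕ) : ℝ) + 4) * 0.6931471808 * (4 * n)
        ≤ (20 : ℝ) * n * ((Nat.log 2 n + 1 : ℕ) : ℝ) := by
      nlinarith
    calc (2 * Real.log 2 + 2 * Real.log N) * (2 * (N : ℝ))
        ≤ (2 * ((Nat.log 2 n + 1 : ℕ) : ℝ) + 4) * Real.log 2 * (2 * N) := by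
          exact mul_le_mul_of_nonneg_right h1 (by positivity)
      _ ≤ (20 : ℝ) * n * ((Nat.log 2 n + 1 : ℕ) : ℝ) := h2.trans h3
      _ ≤ (m : ℝ) ^ 2 := hm2
  have hexp : Real.exp (-((m : ℝ) ^ 2 / (2 * N))) ≤ 1 / (4 * (N : ℝ) ^ 2) := by
    have h4 : (0 : ℝ) < 4 * (N : ℝ) ^ 2 := by positivity
    rw [one_div, ← Real.exp_log h4, ← Real.exp_neg, Real.exp_le_exp]
    linarith
  have hN0 : (N : ℝ) ≠ 0 := hNr.ne'
  rw [show 2 * (N : ℝ) * Real.exp (-((m : ℝ) ^ 2 / (2 * N))) * 2 ^ N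
      = (4 * (N : ℝ) ^ 2 * Real.exp (-((m : ℝ) ^ 2 / (2 * N)))) * (2 ^ N / (2 * N)) by
    field_simp; ring]
  have h3 : 4 * (N : ℝ) ^ 2 * Real.exp (-((m : ℝ) ^ 2 / (2 * N))) ≤ 1 := by
    calc 4 * (N : ℝ) ^ 2 * Real.exp (-((m : ℝ) ^ 2 / (2 * N)))
        ≤ 4 * (N : ℝ) ^ 2 * (1 / (4 * (N : ℝ) ^ 2)) := by gcongr
      _ = 1 := by field_simp
  calc (4 * (N : ℝ) ^ 2 * Real.exp (-((m : ℝ) ^ 2 / (2 * N)))) * (2 ^ N / (2 * N))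
      ≤ 1 * (2 ^ N / (2 * N)) := by gcongr
    _ = 2 ^ N / (2 * N) := one_mul _

/-- **From the spread law to a power of two.**  If `1 ≤ 4 F (n+1)² · 2N (3/4)^{4u}` with `N ≤ 2n`, then
`2^u ≤ 16 n (n+1)² F` (using `(256/81)^u ≥ 2^u`). [folklore] -/
theorem two_pow_le_of_spreadLaw {n N u F : ℕ} (hNle : N ≤ 2 * n)
    (hlaw : (1 : ℝ) ≤ 4 * (F : ℝ) * ((n : ℝ) + 1) ^ 2 * (2 * (N : ℝ) * ((3 : ℝ) / 4) ^ (4 * u))) :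
    2 ^ u ≤ 16 * n * (n + 1) ^ 2 * F := by
  have hNr : (N : ℝ) ≤ 2 * n := by exact_mod_cast hNle
  have hpow : ((3 : ℝ) / 4) ^ (4 * u) = (81 / 256 : ℝ) ^ u := by
    rw [pow_mul]; norm_num
  rw [hpow] at hlaw
  have hq : (0 : ℝ) < (81 / 256 : ℝ) ^ u := by positivity
  have h1 : (1 : ℝ) ≤ 16 * (n : ℝ) * ((n : ℝ) + 1) ^ 2 * (F : ℝ) * (81 / 256 : ℝ) ^ u := by
    calc (1 : ℝ) ≤ 4 * (F : ℝ) * ((n : ℝ) + 1) ^ 2 * (2 * (N : ℝ) * (81 / 256 : ℝ) ^ u) := hlaw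
      _ ≤ 4 * (F : ℝ) * ((n : ℝ) + 1) ^ 2 * (2 * (2 * (n : ℝ)) * (81 / 256 : ℝ) ^ u) := by gcongr
      _ = 16 * (n : ℝ) * ((n : ℝ) + 1) ^ 2 * (F : ℝ) * (81 / 256 : ℝ) ^ u := by ring
  have h2 : ((256 : ℝ) / 81) ^ u ≤ 16 * (n : ℝ) * ((n : ℝ) + 1) ^ 2 * (F : ℝ) := by
    have hprod : ((256 : ℝ) / 81) ^ u * (81 / 256 : ℝ) ^ u = 1 := by
      rw [← mul_pow]; norm_num
    by_contra hlt
    rw [not_le] at hlt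
    have := mul_lt_mul_of_pos_right hlt hq
    rw [hprod] at this
    linarith
  have h3 : (2 : ℝ) ^ u ≤ ((256 : ℝ) / 81) ^ u := pow_le_pow_left₀ (by norm_num) (by norm_num) u
  have h4 : ((2 ^ u : ℕ) : ℝ) ≤ ((16 * n * (n + 1) ^ 2 * F : ℕ) : ℝ) := by
    push_cast
    exact h3.trans h2
  exact_mod_cast h4

/-- **From a power of two to the crux inequality.**  For every `c`, eventually in `n`: if `n ≤ u⁶` and
`2^u ≤ 16 n (n+1)² (F + 1)` then `2^((log₂ n + c)^c) < F + G` (for any `G`). [folklore] -/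
theorem qp_lt_of_two_pow_le (c : ℕ) : ∃ n₀ : ℕ, ∀ n : ℕ, n₀ ≤ n → ∀ u F G : ℕ, n ≤ u ^ 6 →
    2 ^ u ≤ 16 * n * (n + 1) ^ 2 * (F + 1) → 2 ^ ((Nat.log 2 n + c) ^ c) < F + G := by
  obtain ⟨n₂, hn₂⟩ := CorSandwich.polylog_lt_rpow_eventually (c + 2) (c := 1 / 6) (by norm_num)
  refine ⟨max n₂ 4, fun n hn u F G hun hmain => ?_⟩
  have hn2 : n₂ ≤ n := le_trans (le_max_left _ _) hn
  have h4n : 4 ≤ n := le_trans (le_max_right _ _) hn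
  -- `u ≥ n^{1/6} > (log₂ n + c + 2)^{c+2} ≥ (log₂ n + c)^c + 3 log₂ n + 8`
  have hroot : (n : ℝ) ^ ((1 : ℝ) / 6) ≤ u := by
    have hn6 : (n : ℝ) ≤ (u : ℝ) ^ 6 := by exact_mod_cast hun
    have h := Real.rpow_le_rpow (Nat.cast_nonneg n) hn6 (by norm_num : (0 : ℝ) ≤ 1 / 6)
    have h6 : ((u : ℝ) ^ 6) ^ ((1 : ℝ) / 6) = u := by
      rw [show ((1 : ℝ) / 6) = ((6 : ℕ) : ℝ)⁻¹ by norm_num]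
      exact Real.pow_rpow_inv_natCast (Nat.cast_nonneg u) (by norm_num)
    rw [h6] at h
    exact h
  have hpl : (Nat.log 2 n + (c + 2)) ^ (c + 2) < u := by
    have := (hn₂ n hn2).trans_le hroot
    exact_mod_cast this
  have hlog2 : 2 ≤ Nat.log 2 n := Nat.le_log_of_pow_le one_lt_two (by simpa using h4n)
  have hE := polylog_add_le (Nat.log 2 n) c hlog2
  have hE' : (Nat.log 2 n + c) ^ c + 3 * Nat.log 2 n + 8 ≤ u := by
    rw [show Nat.log 2 n + (c + 2) = Nat.log 2 n + c + 2 by ring] at hpl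
    omega
  -- `2^{q + 3ℓ + 8} ≤ 2^u ≤ 16 n (n+1)² (F + 1) < 2^{3ℓ+7} (F + 1)`
  have hsz := sixteen_mul_lt_two_pow n
  have hpow : 2 ^ ((Nat.log 2 n + c) ^ c + 3 * Nat.log 2 n + 8) ≤ 2 ^ u := Nat.pow_le_pow_right Nat.two_pos hE'
  have hsplit : 2 ^ ((Nat.log 2 n + c) ^ c + 3 * Nat.log 2 n + 8)
      = 2 ^ ((Nat.log 2 n + c) ^ c + 1) * 2 ^ (3 * Nat.log 2 n + 7) := by
    rw [← pow_add]; ring_nf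
  have hlt : 2 ^ ((Nat.log 2 n + c) ^ c + 1) * 2 ^ (3 * Nat.log 2 n + 7) < 2 ^ (3 * Nat.log 2 n + 7) * (F + 1) := by
    calc 2 ^ ((Nat.log 2 n + c) ^ c + 1) * 2 ^ (3 * Nat.log 2 n + 7)
        ≤ 16 * n * (n + 1) ^ 2 * (F + 1) := by rw [← hsplit]; exact hpow.trans hmain
      _ < 2 ^ (3 * Nat.log 2 n + 7) * (F + 1) := Nat.mul_lt_mul_of_pos_right hsz (Nat.succ_pos _)
  have hlt' : 2 ^ ((Nat.log 2 n + c) ^ c + 1) < F + 1 := by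
    rw [mul_comm] at hlt
    exact Nat.lt_of_mul_lt_mul_left hlt
  have h2q : 2 ^ ((Nat.log 2 n + c) ^ c + 1) = 2 * 2 ^ ((Nat.log 2 n + c) ^ c) := by ring
  have hk : 1 ≤ 2 ^ ((Nat.log 2 n + c) ^ c) := Nat.one_le_two_pow
  omega

/-! ### §3 Band-avoiding cofactors -/

/-- ★★ **BAND-AVOIDING COFACTORS, every admissible scale.**  Let `u` be admissible at `n`:
`T(u) = 192u⁵ + 176u⁴ + 29u³ + 24u + 4 ≤ n` and `20 n (log₂ n + 1) ≤ u⁶`.  Then every `h ≠ 0` NONE of whose variables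
`x_(i,j)` has `j − i` in the band `B(u) = [8u⁴ + 2u³ + 1, 16u⁴ + 8u³ − 1]` satisfies `2^u ≤ 16 n (n+1)² (L₊(NN_n · h) + 1)`.
[cite: HrubesYehudayoff2021, §6 Problem 2] [cite: Burgisser2000, Rem. 2.7] -/
theorem bandAvoiding_lower_bound {u : ℕ} (hu : 1 ≤ u)
    (hT : 192 * u ^ 5 + 176 * u ^ 4 + 29 * u ^ 3 + 24 * u + 4 ≤ n) (hlog : 20 * n * (Nat.log 2 n + 1) ≤ u ^ 6)
    {h : MvPolynomial (Fin (2 * n) × Fin (2 * n)) ℝ≥0} (hh : h ≠ 0)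
    (havoid : ∀ e ∈ h.vars, (e.2 : ℕ) < (e.1 : ℕ) + (8 * u ^ 4 + 2 * u ^ 3 + 1) ∨
      (e.1 : ℕ) + (16 * u ^ 4 + 8 * u ^ 3) ≤ (e.2 : ℕ)) :
    2 ^ u ≤ 16 * n * (n + 1) ^ 2 * (complexity (nestFreeMatchingPoly n ℝ≥0 * h) + 1) := by
  classical
  -- the parameters
  set m : ℕ := u ^ 3 with hm
  set L : ℕ := 8 * m * u + 3 * m with hL
  set K : ℕ := 2 * L + 4 * m + 2 with hK
  set N : ℕ := 2 * n - 2 * L with hN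
  have hT' : 12 * K * u + 3 * L + 2 * K ≤ n := by
    have : 12 * K * u + 3 * L + 2 * K = 192 * u ^ 5 + 176 * u ^ 4 + 29 * u ^ 3 + 24 * u + 4 := by
      simp only [hK, hL, hm]; ring
    rw [this]; exact hT
  have hNle : N ≤ 2 * n := by rw [hN]; omega
  have hNpos : 0 < N := by
    have eT : 12 * K * u = 12 * (K * u) := by ring
    rw [eT] at hT'
    rw [hN]; omega
  have hn3 : 3 ≤ n := by omega
  have hm2 : 20 * n * (Nat.log 2 n + 1) ≤ m ^ 2 := by
    rw [hm, ← pow_mul]; exact hlog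
  have hband := band_estimate_of_log hNpos hNle hm2
  -- the banded measure and the generic local law
  obtain ⟨μ, hμ1, hμS, hμB⟩ := exists_thick_measure_of_le_band hu hm hL hK hN hT' hband
  set I : Finset (Fin (2 * n) × Fin (2 * n)) := univ.filter fun e =>
    ¬ ((e.1 : ℕ) + (8 * u ^ 4 + 2 * u ^ 3 + 1) ≤ (e.2 : ℕ) ∧ (e.2 : ℕ) + 1 ≤ (e.1 : ℕ) + (16 * u ^ 4 + 8 * u ^ 3))
    with hI
  have hμI : ∀ M ∈ nestFreeMatchings (2 * n), μ M ≠ 0 → ∀ i ∈ openers M, (i, M i) ∉ I := by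
    intro M hM hμM i hi
    have hb := hμB M hM hμM i hi
    rw [hI, mem_filter, not_and, not_not]
    exact fun _ => hb
  have hloc : ∀ e ∈ h.vars, e ∈ I := by
    intro e he
    rw [hI, mem_filter]
    refine ⟨mem_univ _, fun hb => ?_⟩
    rcases havoid e he with h1 | h1 <;> omega
  have hlaw := local_spreadLaw hn3 I μ hμ1 hμI hμS hh hloc
  exact two_pow_le_of_spreadLaw hNle (by exact_mod_cast hlaw)

/-- ★★ **BAND-AVOIDING COFACTORS ARE NOT CERTIFICATES — CERTIFICATES ARE SCALE-COVERING.**  For every `c`, eventually in `n`: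
for every admissible `u` (`T(u) ≤ n`, `20 n (log₂ n + 1) ≤ u⁶`) and every `h ≠ 0` none of whose variables `x_(i,j)` has
`j − i ∈ B(u) = [8u⁴ + 2u³ + 1, 16u⁴ + 8u³ − 1]`, the crux inequality `2^((log₂ n + c)^c) < L₊(NN_n · h) + L₊(h)` holds.
[cite: HrubesYehudayoff2021, §6 Problem 2] [cite: Burgisser2000, Rem. 2.7] -/
theorem bandAvoiding_not_certificate_qp (c : ℕ) : ∃ n₀ : ℕ, ∀ n : ℕ, n₀ ≤ n → ∀ u : ℕ,
    192 * u ^ 5 + 176 * u ^ 4 + 29 * u ^ 3 + 24 * u + 4 ≤ n → 20 * n * (Nat.log 2 n + 1) ≤ u ^ 6 →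
    ∀ h : MvPolynomial (Fin (2 * n) × Fin (2 * n)) ℝ≥0, h ≠ 0 →
      (∀ e ∈ h.vars, (e.2 : ℕ) < (e.1 : ℕ) + (8 * u ^ 4 + 2 * u ^ 3 + 1) ∨
        (e.1 : ℕ) + (16 * u ^ 4 + 8 * u ^ 3) ≤ (e.2 : ℕ)) →
      2 ^ ((Nat.log 2 n + c) ^ c) < complexity (nestFreeMatchingPoly n ℝ≥0 * h) + complexity h := by
  obtain ⟨n₀, hn₀⟩ := qp_lt_of_two_pow_le c
  refine ⟨n₀, fun n hn u hT hlog h hh havoid => ?_⟩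
  have hun : n ≤ u ^ 6 := by
    have : n ≤ 20 * n * (Nat.log 2 n + 1) := by nlinarith
    exact this.trans hlog
  have h6 : u ^ 6 ≠ 0 := by
    intro h0
    rw [h0] at hun
    omega
  have hu : 1 ≤ u := Nat.pos_of_ne_zero fun h0 => h6 (by rw [h0]; norm_num)
  exact hn₀ n hn u _ _ hun (bandAvoiding_lower_bound hu hT hlog hh havoid)

/-! ### §4 By name -/

/-- ★ **BY NAME: `NNDivisionHard` ⟺ its SCALE-COVERING tier.**  The crux (stmt-ValiantsHypothesis-21181) is equivalent to the
same inequality for the cofactors `h` which, for EVERY admissible `u` (`T(u) ≤ n`, `20 n (log₂ n + 1) ≤ u⁶`), have a variable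
`x_(i,j)` with `j − i` in the band `[8u⁴ + 2u³ + 1, 16u⁴ + 8u³ − 1]`. [cite: HrubesYehudayoff2021, §6 Problem 2] -/
theorem nnDivisionHard_iff_scaleCoveringTier :
    Summit.ValiantsHypothesis.ValiantsHypothesis.Theses.FifoMatching.NNDivisionHard ↔
    ∀ c : ℕ, ∃ n₀ : ℕ, ∀ n ≥ n₀, ∀ h : MvPolynomial (Fin (2 * n) × Fin (2 * n)) ℝ≥0, h ≠ 0 →
      (∀ u : ℕ, 192 * u ^ 5 + 176 * u ^ 4 + 29 * u ^ 3 + 24 * u + 4 ≤ n → 20 * n * (Nat.log 2 n + 1) ≤ u ^ 6 →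
        ∃ e ∈ h.vars, (e.1 : ℕ) + (8 * u ^ 4 + 2 * u ^ 3 + 1) ≤ (e.2 : ℕ) ∧
          (e.2 : ℕ) + 1 ≤ (e.1 : ℕ) + (16 * u ^ 4 + 8 * u ^ 3)) →
      2 ^ ((Nat.log 2 n + c) ^ c) < complexity (nestFreeMatchingPoly n ℝ≥0 * h) + complexity h := by
  constructor
  · intro hN c
    obtain ⟨n₀, hn₀⟩ := hN c
    exact ⟨n₀, fun n hn h hh _ => hn₀ n hn h hh⟩
  · intro H c
    obtain ⟨n₀, hn₀⟩ := H c
    obtain ⟨n₁, hn₁⟩ := bandAvoiding_not_certificate_qp c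
    refine ⟨max n₀ n₁, fun n hn h hh => ?_⟩
    by_cases hcov : ∀ u : ℕ, 192 * u ^ 5 + 176 * u ^ 4 + 29 * u ^ 3 + 24 * u + 4 ≤ n →
        20 * n * (Nat.log 2 n + 1) ≤ u ^ 6 →
        ∃ e ∈ h.vars, (e.1 : ℕ) + (8 * u ^ 4 + 2 * u ^ 3 + 1) ≤ (e.2 : ℕ) ∧
          (e.2 : ℕ) + 1 ≤ (e.1 : ℕ) + (16 * u ^ 4 + 8 * u ^ 3)
    · exact hn₀ n (le_trans (le_max_left _ _) hn) h hh hcov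
    · push Not at hcov
      obtain ⟨u, hT, hlog, hav⟩ := hcov
      refine hn₁ n (le_trans (le_max_right _ _) hn) u hT hlog h hh fun e he => ?_
      have := hav e he
      omega

end Summit.ValiantsHypothesis.ValiantsHypothesis.Theorems.FifoMatching.NNDivisionHard.BandLocal

end
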